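import Mathlib.Algebra.Order.BigOperators.Ring.Finset
import Mathlib.Analysis.SpecialFunctions.Exp
import Mathlib.Analysis.SpecialFunctions.Log.Basic
import HarnessLib

/-!
# Constructible, indistinguishable, far-apart ensembles give one-way functions, I: two elementary estimates

First file of the discharge of the named fact
`Literature.Computability.Cryptography.Goldreich2001_owfExist_of_indistinguishable_farApart`
(`IndistinguishableFarEnsembles.lean`; Goldreich 2001, §3.8 Exercise 11 = Goldreich 2010, Exercise 2.8 with the
weaker conclusion "one-way functions exist"). The discharge follows the printed guideline — the function
`(σ, r) ↦ S_σ(r)` built from the two samplers is *distributionally* hard to invert, and Impagliazzo–Luby's hashing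
argument (Goldreich 2001, Ch. 2, Exercise 17: `F(x, i, h) = (f(x), h_i(x), i, h)` is weakly one-way) turns this
into a weak one-way function, then Yao's amplification (in the tree) into a one-way function — with two
simplifications recorded in the later files: no preliminary amplification of the statistical distance (the
"posterior-sampling" distinguisher already has advantage `≥ Δ²`, first lemma below), and a top-down scan over
the hash levels in place of Impagliazzo–Luby's estimation of the right level (second group of lemmas below).

This file is pure real analysis, with no cryptographic content:

* `sq_sum_abs_sub_le` — **the `Δ²` bound**: for nonnegative families `p, q` on a finite set with equal sums,
  `(∑ |q - p|)² ≤ 2 (∑ (p + q)) · ∑ (q - p) · q/(p + q)`; with `∑ p = ∑ q = ½` (the two halves of a mixture)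
  the right-hand factor `∑ (q - p) q/(p+q)` is the advantage of the distinguisher that outputs the hidden bit
  of a uniformly random preimage, and the left-hand side is `Δ²`. (Proof: `∑ (q-p) q/(p+q) = ½ ∑ (q-p)²/(p+q)`
  because `∑ (q - p) = 0`, then Sedrakyan's form of Cauchy–Schwarz, `Finset.sq_sum_div_le_sum_sq_div`.)
* `FirstSucc.run` — the acceptance probability of a **"first success" process**: independent attempts
  `a = 1, 2, …` succeed with probability `p_a`, and succeed *with answer `1`* with probability `s_a ≤ p_a`; the
  process outputs the answer of the first successful attempt, and `1` with probability `c` if all fail: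
  `run ((p,s) :: rest) c = s + (1 - p) · run rest c`. `FirstSucc.abs_run_sub_le`: for any target `π ∈ [0,1]`
  and any initial segment of the attempts,
  `|run - π| ≤ ∑_a ∏_{b<a} (1 - p_b) |s_a - p_a π| + ∏_a (1 - p_a)` (sums over the segment);
  `FirstSucc.abs_run_sub_le_of_le`: if on the segment `|s_a - p_a π| ≤ θ x_a` and `x_a/2 ≤ p_a` with
  `x_a ∈ [0,1]`, then `|run - π| ≤ 2θ + exp (-(∑_a x_a)/2)`.

## References

* O. Goldreich, *Foundations of Cryptography I*, CUP 2001, §3.8 Exercise 11 and Ch. 2 Exercise 17 (guidelines).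
* R. Impagliazzo, M. Luby, *One-way functions are essential for complexity based cryptography*, FOCS 1989
  (distributionally one-way functions yield one-way functions).
-/

namespace Literature.Computability.Cryptography

namespace FarApartOWF

open Finset Real

/-! ### The `Δ²` bound (Cauchy–Schwarz) -/

/-- `∑ (q - p) · q/(p+q) = ½ ∑ (q - p)²/(p + q)` when `∑ p = ∑ q` (terms with `p + q = 0` vanish on both sides,
`x / 0 = 0`). [folklore] -/
theorem sum_sub_mul_div_eq {ι : Type*} (s : Finset ι) (p q : ι → ℝ) (hp : ∀ i ∈ s, 0 ≤ p i) (hq : ∀ i ∈ s, 0 ≤ q i)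
    (hsum : ∑ i ∈ s, p i = ∑ i ∈ s, q i) :
    ∑ i ∈ s, (q i - p i) * (q i / (p i + q i)) = 2⁻¹ * ∑ i ∈ s, (q i - p i) ^ 2 / (p i + q i) := by
  have hzero : ∑ i ∈ s, (q i - p i) = 0 := by rw [Finset.sum_sub_distrib, hsum, sub_self]
  have hterm : ∀ i ∈ s, (q i - p i) * (q i / (p i + q i)) = 2⁻¹ * ((q i - p i) ^ 2 / (p i + q i)) + 2⁻¹ * (q i - p i) := by
    intro i hi
    rcases (add_nonneg (hp i hi) (hq i hi)).eq_or_lt with h0 | hpos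
    · have hp0 : p i = 0 := by linarith [hp i hi, hq i hi]
      have hq0 : q i = 0 := by linarith [hp i hi, hq i hi]
      simp [hp0, hq0]
    · field_simp
      ring
  rw [Finset.sum_congr rfl hterm, Finset.sum_add_distrib, ← Finset.mul_sum, ← Finset.mul_sum, hzero, mul_zero, add_zero]

/-- **The `Δ²` bound.** For nonnegative `p, q` on a finite set with `∑ p = ∑ q`:
`(∑ |q - p|)² ≤ 2 (∑ (p + q)) · ∑ (q - p) q/(p + q)`. With `p, q` the two halves of an equal mixture
(`∑ p = ∑ q = ½`, `∑ |q - p| = Δ`) this reads `Δ² ≤ 2 · advantage` of the posterior-sampling test… precisely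
`Δ² ≤ 2 ∑ (q-p) q/(p+q)`. (Goldreich's guideline amplifies `Δ` to `1 - 2⁻ⁿ` instead; this inequality makes the
amplification unnecessary.) [folklore] -/
theorem sq_sum_abs_sub_le {ι : Type*} (s : Finset ι) (p q : ι → ℝ) (hp : ∀ i ∈ s, 0 ≤ p i) (hq : ∀ i ∈ s, 0 ≤ q i)
    (hsum : ∑ i ∈ s, p i = ∑ i ∈ s, q i) :
    (∑ i ∈ s, |q i - p i|) ^ 2 ≤ 2 * (∑ i ∈ s, (p i + q i)) * ∑ i ∈ s, (q i - p i) * (q i / (p i + q i)) := by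
  classical
  -- restrict to the terms with `p + q > 0`
  set s' := s.filter fun i => 0 < p i + q i with hs'
  have hsub : s' ⊆ s := Finset.filter_subset _ _
  have hvan : ∀ i ∈ s, i ∉ s' → p i = 0 ∧ q i = 0 := by
    intro i hi hi'
    have : ¬ 0 < p i + q i := fun h => hi' (Finset.mem_filter.2 ⟨hi, h⟩)
    constructor <;> linarith [hp i hi, hq i hi]
  have h1 : ∑ i ∈ s, |q i - p i| = ∑ i ∈ s', |q i - p i| := by
    refine (Finset.sum_subset hsub fun i hi hi' => ?_).symm
    obtain ⟨h0, h0'⟩ := hvan i hi hi'; simp [h0, h0']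
  have h2 : ∑ i ∈ s, (p i + q i) = ∑ i ∈ s', (p i + q i) := by
    refine (Finset.sum_subset hsub fun i hi hi' => ?_).symm
    obtain ⟨h0, h0'⟩ := hvan i hi hi'; simp [h0, h0']
  have h3 : ∑ i ∈ s, (q i - p i) ^ 2 / (p i + q i) = ∑ i ∈ s', (q i - p i) ^ 2 / (p i + q i) := by
    refine (Finset.sum_subset hsub fun i hi hi' => ?_).symm
    obtain ⟨h0, h0'⟩ := hvan i hi hi'; simp [h0, h0']
  rw [sum_sub_mul_div_eq s p q hp hq hsum, h1, h2, h3]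
  have hpos : ∀ i ∈ s', 0 < p i + q i := fun i hi => (Finset.mem_filter.1 hi).2
  have hsed := Finset.sq_sum_div_le_sum_sq_div s' (fun i => |q i - p i|) hpos
  simp only [sq_abs] at hsed
  rcases (Finset.sum_nonneg fun i hi => (hpos i hi).le).eq_or_lt with hS0 | hSpos
  · -- `s'` is empty
    have hempty : s' = ∅ := by
      by_contra hne
      obtain ⟨i, hi⟩ := Finset.nonempty_iff_ne_empty.2 hne
      have := Finset.sum_pos hpos ⟨i, hi⟩
      linarith
    simp [hempty]
  · rw [div_le_iff₀ hSpos] at hsed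
    nlinarith [hsed]

/-! ### The "first success" process -/

namespace FirstSucc

/-- **Acceptance probability of the first-success process**: attempts `(p_a, s_a)` in order (`p_a` = probability
that attempt `a` succeeds, `s_a` = probability that it succeeds with answer `1`), final answer `1` with
probability `c` if every attempt fails. [folklore] -/
noncomputable def run : List (ℝ × ℝ) → ℝ → ℝ
  | [], c => c
  | a :: rest, c => a.2 + (1 - a.1) * run rest c

/-- `run [] c = c`. [folklore] -/
@[simp] theorem run_nil (c : ℝ) : run [] c = c := rfl

/-- `run ((p, s) :: rest) c = s + (1 - p) · run rest c`. [folklore] -/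
@[simp] theorem run_cons (a : ℝ × ℝ) (rest : List (ℝ × ℝ)) (c : ℝ) : run (a :: rest) c = a.2 + (1 - a.1) * run rest c := rfl

/-- `run` on a concatenation: the second list is the continuation. [folklore] -/
theorem run_append (l l' : List (ℝ × ℝ)) (c : ℝ) : run (l ++ l') c = run l (run l' c) := by
  induction l with
  | nil => rfl
  | cons a l ih => simp [ih]

/-- `run` takes values in `[0,1]` when `0 ≤ s_a ≤ p_a ≤ 1` and `c ∈ [0,1]`. [folklore] -/
theorem run_mem_Icc : ∀ (l : List (ℝ × ℝ)) {c : ℝ}, (∀ a ∈ l, 0 ≤ a.2 ∧ a.2 ≤ a.1 ∧ a.1 ≤ 1) → 0 ≤ c → c ≤ 1 →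
    0 ≤ run l c ∧ run l c ≤ 1
  | [], c, _, h0, h1 => ⟨h0, h1⟩
  | a :: rest, c, hl, h0, h1 => by
    obtain ⟨ha0, hsp, hp1⟩ := hl a (by simp)
    obtain ⟨hr0, hr1⟩ := run_mem_Icc rest (fun b hb => hl b (by simp [hb])) h0 h1
    rw [run_cons]
    constructor
    · nlinarith
    · nlinarith

/-- The product `∏_{a} (1 - x_a / 2)` along a list of attempts. [folklore] -/
noncomputable def halfProd {α : Type*} (x : α → ℝ) (as : List α) : ℝ := (as.map fun a => 1 - x a / 2).prod

/-- `halfProd x [] = 1`. [folklore] -/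
@[simp] theorem halfProd_nil {α : Type*} (x : α → ℝ) : halfProd x [] = 1 := by simp [halfProd]

/-- `halfProd x (a :: as) = (1 - x a / 2) · halfProd x as`. [folklore] -/
@[simp] theorem halfProd_cons {α : Type*} (x : α → ℝ) (a : α) (as : List α) :
    halfProd x (a :: as) = (1 - x a / 2) * halfProd x as := by simp [halfProd]

/-- `halfProd ∈ [0, 1]` for `x_a ∈ [0, 1]`. [folklore] -/
theorem halfProd_mem_Icc {α : Type*} (x : α → ℝ) : ∀ as : List α, (∀ a ∈ as, 0 ≤ x a ∧ x a ≤ 1) →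
    0 ≤ halfProd x as ∧ halfProd x as ≤ 1
  | [], _ => by simp
  | a :: as, h => by
    obtain ⟨h0, h1⟩ := h a (by simp)
    obtain ⟨ih0, ih1⟩ := halfProd_mem_Icc x as (fun b hb => h b (by simp [hb]))
    rw [halfProd_cons]
    exact ⟨mul_nonneg (by linarith) ih0, by nlinarith⟩

/-- `∏ (1 - x_a/2) ≤ exp (-(∑ x_a)/2)` for `x_a ∈ [0, 1]` (`1 - y ≤ e^{-y}`). [folklore] -/
theorem halfProd_le_exp {α : Type*} (x : α → ℝ) : ∀ as : List α, (∀ a ∈ as, 0 ≤ x a ∧ x a ≤ 1) →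
    halfProd x as ≤ Real.exp (-((as.map x).sum) / 2)
  | [], _ => by simp
  | a :: as, h => by
    obtain ⟨h0, h1⟩ := h a (by simp)
    have hrest : ∀ b ∈ as, 0 ≤ x b ∧ x b ≤ 1 := fun b hb => h b (by simp [hb])
    have ih := halfProd_le_exp x as hrest
    have hP := (halfProd_mem_Icc x as hrest).1
    rw [halfProd_cons, List.map_cons, List.sum_cons, neg_add, add_div, Real.exp_add]
    have h2 : 1 - x a / 2 ≤ Real.exp (-x a / 2) := by
      have := Real.add_one_le_exp (-x a / 2); linarith
    exact mul_le_mul h2 ih hP (Real.exp_pos _).le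

/-- **The telescoping bound** (the form used by the scan analysis). Attempts `as` (mapped to their `(p_a, s_a)`
by `f`) followed by arbitrary further attempts `late`; if on `as` each attempt has bias `|s_a - p_a π| ≤ θ x_a`
and success probability `p_a ≥ x_a/2` for numbers `x_a ∈ [0,1]`, then
`|run - π| ≤ 2θ (1 - ∏ (1 - x_a/2)) + ∏ (1 - x_a/2)`. (Induction: `run - π = (s - pπ) + (1 - p)(run' - π)`.)
[folklore] -/
theorem abs_run_sub_le {α : Type*} (f : α → ℝ × ℝ) (x : α → ℝ) (late : List (ℝ × ℝ)) {c π θ : ℝ}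
    (hlate : ∀ a ∈ late, 0 ≤ a.2 ∧ a.2 ≤ a.1 ∧ a.1 ≤ 1) (h0 : 0 ≤ c) (h1 : c ≤ 1) (hπ0 : 0 ≤ π) (hπ1 : π ≤ 1)
    (hθ : 0 ≤ θ) :
    ∀ as : List α, (∀ a ∈ as, 0 ≤ (f a).2 ∧ (f a).2 ≤ (f a).1 ∧ (f a).1 ≤ 1) →
      (∀ a ∈ as, 0 ≤ x a ∧ x a ≤ 1) → (∀ a ∈ as, |(f a).2 - (f a).1 * π| ≤ θ * x a) →
      (∀ a ∈ as, x a / 2 ≤ (f a).1) →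
      |run (as.map f ++ late) c - π| ≤ 2 * θ * (1 - halfProd x as) + halfProd x as
  | [], _, _, _, _ => by
    obtain ⟨hr0, hr1⟩ := run_mem_Icc late hlate h0 h1
    simp only [List.map_nil, List.nil_append, halfProd_nil, sub_self, mul_zero, zero_add]
    rw [abs_le]; constructor <;> linarith
  | a :: as, hf, hx, hbias, hsucc => by
    have ih := abs_run_sub_le f x late hlate h0 h1 hπ0 hπ1 hθ as (fun b hb => hf b (by simp [hb]))
      (fun b hb => hx b (by simp [hb])) (fun b hb => hbias b (by simp [hb])) (fun b hb => hsucc b (by simp [hb]))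
    obtain ⟨hs0, hsp, hp1⟩ := hf a (by simp)
    obtain ⟨hx0, hx1⟩ := hx a (by simp)
    have hb := hbias a (by simp)
    have hsc := hsucc a (by simp)
    obtain ⟨hP0, hP1⟩ := halfProd_mem_Icc x as (fun b hb => hx b (by simp [hb]))
    simp only [List.map_cons, List.cons_append, run_cons, halfProd_cons]
    set R := run (as.map f ++ late) c with hR
    set P := halfProd x as with hP
    have hdecomp : (f a).2 + (1 - (f a).1) * R - π = ((f a).2 - (f a).1 * π) + (1 - (f a).1) * (R - π) := by ring
    rw [hdecomp]
    have hbr : 0 ≤ 2 * θ * (1 - P) + P := by nlinarith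
    calc |(f a).2 - (f a).1 * π + (1 - (f a).1) * (R - π)|
        ≤ |(f a).2 - (f a).1 * π| + |(1 - (f a).1) * (R - π)| := abs_add_le _ _
      _ = |(f a).2 - (f a).1 * π| + (1 - (f a).1) * |R - π| := by
          rw [abs_mul, abs_of_nonneg (by linarith : (0 : ℝ) ≤ 1 - (f a).1)]
      _ ≤ θ * x a + (1 - x a / 2) * (2 * θ * (1 - P) + P) := by
          gcongr
          · linarith
      _ = 2 * θ * (1 - (1 - x a / 2) * P) + (1 - x a / 2) * P := by ring

/-- **Corollary**: under the same hypotheses `|run - π| ≤ 2θ + exp (-(∑_{a ∈ as} x_a)/2)`. [folklore] -/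
theorem abs_run_sub_le_exp {α : Type*} (f : α → ℝ × ℝ) (x : α → ℝ) (late : List (ℝ × ℝ)) {c π θ : ℝ}
    (hlate : ∀ a ∈ late, 0 ≤ a.2 ∧ a.2 ≤ a.1 ∧ a.1 ≤ 1) (h0 : 0 ≤ c) (h1 : c ≤ 1) (hπ0 : 0 ≤ π) (hπ1 : π ≤ 1)
    (hθ : 0 ≤ θ) (as : List α) (hf : ∀ a ∈ as, 0 ≤ (f a).2 ∧ (f a).2 ≤ (f a).1 ∧ (f a).1 ≤ 1)
    (hx : ∀ a ∈ as, 0 ≤ x a ∧ x a ≤ 1) (hbias : ∀ a ∈ as, |(f a).2 - (f a).1 * π| ≤ θ * x a)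
    (hsucc : ∀ a ∈ as, x a / 2 ≤ (f a).1) :
    |run (as.map f ++ late) c - π| ≤ 2 * θ + Real.exp (-((as.map x).sum) / 2) := by
  have h := abs_run_sub_le f x late hlate h0 h1 hπ0 hπ1 hθ as hf hx hbias hsucc
  obtain ⟨hP0, hP1⟩ := halfProd_mem_Icc x as hx
  have he := halfProd_le_exp x as hx
  nlinarith

end FirstSucc

end FarApartOWF

end Literature.Computability.Cryptography
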